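import Mathlib
import Summits.NavierStokesRegularity.NavierStokesRegularity.Theorems.LerayQuarterDissipationFiniteDissipationLiouvilleCriticalProductionCredit
import Summits.NavierStokesRegularity.NavierStokesRegularity.Theorems.LerayQuarterDissipationFiniteDissipationLiouvilleEndpointSchemeFarPast
import HarnessLib

/-!
# Route `LerayQuarterDissipation`, crux `FiniteDissipationLiouville` (stmt-NavierStokesRegularity-22144), line `birth` —
# CRITICAL PRODUCTION WITH PALINSTROPHY CREDIT IN THE FAR PAST IS A LIOUVILLE THEOREM

Seat ns-lqd-lead g18 (LEAD of 22144, cell ns-idea-3; helper `--supports` 22144).  The all-time row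
`…CriticalProductionCredit.eq_zero_of_critical_production_credit` (`a < 1`:
`(−t)(⟪ω, DV ω⟫ − a|∇ω|²_F) ≤ |ω|²` everywhere ⇒ `V ≡ 0`) is made EVENTUAL towards `t = −∞`, envelope-free and
law-free:

* `critProdCredit_translate_at`, `critProdCredit_nsRescale_at`, `critProdCredit_of_limit_at` — the hypothesis at a
  single space-time point is transported by translations and parabolic rescalings and is closed under the KNSS
  limits of the class (`…Compactness.seqLimit`; second derivatives by `…EndpointScheme.tendsto_fderiv_curl_of_unif`);
* `curl_eq_zero_until_of_critProdCredit_until` — **REGIONAL HOT SPOT**: if the hypothesis holds on `(−∞, τ] × ℝ³`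
  (`τ < 0`) then `curl V ≡ 0` there.  The supremum `M` of `t²|ω|²` over `t ≤ τ` is renormalised to the hot spot
  `(−1, 0)` (`v ↦ √(−t_k) v(−t_k ·, x_k + √(−t_k) ·)` maps `t ≤ −1` INTO `t ≤ τ` because `t_k ≤ τ`), the KNSS limit
  `W` carries the hypothesis and the bound `M` on `t ≤ −1` and attains `M` at the TOP of the slab `[−2, −1] × ℝ³`;
  the strong maximum principle (`…StrongMaxPrinciple.dissipation_eq_zero_of_max`) kills `(1−a)|∇ω_W|²_F` inside,
  a constant vorticity slice forces `W ≡ 0` (`eq_zero_of_curl_translate_eq_slice`) — against `M > 0`;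
* **`eq_zero_of_critProdCredit_farPast`** — hence `V ≡ 0` on `t < 0` (bounded curl-free divergence-free slices are
  constant, KNSS Lemma 3.1; constant slices on a past half-line vanish in the gauge and forward uniqueness does the
  rest, `…EndpointScheme.eq_zero_of_const_slices_until`);
* PORTRAIT `production_excess_recedes_of_ne_zero` — a KNSS-gauge Type-I field not identically zero has, for every
  `a < 1` and every `τ < 0`, a point `(s, y)` with `s ≤ τ` and `|ω|² < (−s)(⟪ω, DV ω⟫ − a|∇ω|²_F)`: the
  super-critical production RECEDES INTO THE FAR PAST (and, by `…CriticalProductionApex`, accumulates at the apex of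
  a singular element).

WHAT THIS IS NOT: not a claim about Navier–Stokes regularity and not the crux — a Liouville-type stratum of the
portrait of the hypothetical minimal ancient element (bears_on LADDER-NS N0).
-/

noncomputable section

-- the summit and its single sub-problem share the name (CONVENTIONS §1), as in every Theorems file
set_option linter.dupNamespace false

namespace Summit.NavierStokesRegularity.NavierStokesRegularity.Theorems.FiniteDissipationLiouville.CriticalProduction

open MeasureTheory Set Function Filter Topology TopologicalSpace Metric InnerProductSpace
open scoped RealInnerProductSpace InnerProductSpace Laplacian ContDiff
open Literature.Analysis Literature.Analysis.FluidPDE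
open Summit.NavierStokesRegularity.NavierStokesRegularity.Theorems
open Summit.NavierStokesRegularity.NavierStokesRegularity.Theorems.LocalSineTubeDoorProfileAlignedWindowRigidityAncient
open Summit.NavierStokesRegularity.NavierStokesRegularity.Theorems.PoloidalWindowDoorPoloidalWindowRigidityWindow
open Summit.NavierStokesRegularity.NavierStokesRegularity.Theorems.PoloidalWindowDoorPoloidalWindowRigidityClassRate
open Summit.NavierStokesRegularity.NavierStokesRegularity.Theorems.LocalSineTubeDoorEnstrophyProductionProfileRigidity
open Summit.NavierStokesRegularity.NavierStokesRegularity.Theorems.PoloidalWindowDoorPoloidalWindowRigidityDegenerate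
open Summit.NavierStokesRegularity.NavierStokesRegularity.Theorems.PoloidalWindowDoorPoloidalWindowRigidityFlat
open Summit.NavierStokesRegularity.NavierStokesRegularity.Theorems.PoloidalWindowDoorPoloidalWindowRigidityStrainRate
open Summit.NavierStokesRegularity.NavierStokesRegularity.Theorems.PoloidalWindowDoorPoloidalWindowRigidityPoloidalExtremal
open Summit.NavierStokesRegularity.NavierStokesRegularity.Theorems.PoloidalWindowDoorPoloidalWindowRigidityEnstrophyHotSpot
open Summit.NavierStokesRegularity.NavierStokesRegularity.Theorems.PoloidalWindowDoorPoloidalWindowRigidityStrongMaxPrinciple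
open Summit.NavierStokesRegularity.NavierStokesRegularity.Theorems.PoloidalWindowDoorPoloidalWindowRigidityVorticityTranslate
open Summit.NavierStokesRegularity.NavierStokesRegularity.Theorems.PoloidalWindowDoorPoloidalWindowRigidityCriticalProduction
open Summit.NavierStokesRegularity.NavierStokesRegularity.Theorems.FiniteDissipationLiouville.EndpointScheme

variable {C : ℝ} {V : ℝ → EuclideanSpace ℝ (Fin 3) → EuclideanSpace ℝ (Fin 3)}

/-! ### The hypothesis at one point: translations, rescalings, limits -/

/-- The hypothesis at the point `(s, x₀ + y)` of `u` is the hypothesis at `(s, y)` of the translate `u(·, x₀ + ·)`.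
[folklore] -/
theorem critProdCredit_translate_at {a : ℝ} {u : ℝ → EuclideanSpace ℝ (Fin 3) → EuclideanSpace ℝ (Fin 3)}
    (x₀ : EuclideanSpace ℝ (Fin 3)) {s : ℝ} {y : EuclideanSpace ℝ (Fin 3)}
    (h : (-s) * (⟪curl (u s) (x₀ + y), fderiv ℝ (u s) (x₀ + y) (curl (u s) (x₀ + y))⟫_ℝ
        - a * frobeniusNormSq (fderiv ℝ (curl (u s)) (x₀ + y))) ≤ ⟪curl (u s) (x₀ + y), curl (u s) (x₀ + y)⟫_ℝ) :
    (-s) * (⟪curl (fun x => u s (x₀ + x)) y,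
        fderiv ℝ (fun x => u s (x₀ + x)) y (curl (fun x => u s (x₀ + x)) y)⟫_ℝ
        - a * frobeniusNormSq (fderiv ℝ (curl (fun x => u s (x₀ + x))) y)) ≤
      ⟪curl (fun x => u s (x₀ + x)) y, curl (fun x => u s (x₀ + x)) y⟫_ℝ := by
  have e : curl (fun x => u s (x₀ + x)) = fun x => curl (u s) (x₀ + x) := funext fun x => curl_translate _ _ _
  rw [e, fderiv_translate, fderiv_translate]
  exact h

/-- The hypothesis at the point `(c²s, c y)` of `u` is the hypothesis at `(s, y)` of `nsRescale c u` (`c > 0`,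
`s < 0`: every term picks up `c⁴`). [folklore] -/
theorem critProdCredit_nsRescale_at {a : ℝ} {u : ℝ → EuclideanSpace ℝ (Fin 3) → EuclideanSpace ℝ (Fin 3)} {c : ℝ}
    (hc : 0 < c) {s : ℝ} {y : EuclideanSpace ℝ (Fin 3)}
    (h : (-(c ^ 2 * s)) * (⟪curl (u (c ^ 2 * s)) (c • y),
        fderiv ℝ (u (c ^ 2 * s)) (c • y) (curl (u (c ^ 2 * s)) (c • y))⟫_ℝ
        - a * frobeniusNormSq (fderiv ℝ (curl (u (c ^ 2 * s))) (c • y))) ≤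
      ⟪curl (u (c ^ 2 * s)) (c • y), curl (u (c ^ 2 * s)) (c • y)⟫_ℝ) :
    (-s) * (⟪curl (nsRescale c u s) y,
        fderiv ℝ (nsRescale c u s) y (curl (nsRescale c u s) y)⟫_ℝ
        - a * frobeniusNormSq (fderiv ℝ (curl (nsRescale c u s)) y)) ≤
      ⟪curl (nsRescale c u s) y, curl (nsRescale c u s) y⟫_ℝ := by
  rw [curl_nsRescale_slice, fderiv_nsRescale_slice, fderiv_curl_nsRescale, frobeniusNormSq_smul_eq]
  simp only [smul_apply, map_smul, real_inner_smul_left, real_inner_smul_right]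
  have hc4 : 0 ≤ c ^ 2 * c ^ 2 := by positivity
  have e6 : (c * c * c) ^ 2 = c ^ 2 * (c ^ 2 * c ^ 2) := by ring
  rw [e6]
  have h2 := mul_le_mul_of_nonneg_left h hc4
  have e7 : -s * (c ^ 2 * (c ^ 2 * (c ^ 2 * ⟪curl (u (c ^ 2 * s)) (c • y),
        (fderiv ℝ (u (c ^ 2 * s)) (c • y)) (curl (u (c ^ 2 * s)) (c • y))⟫_ℝ)) -
        a * (c ^ 2 * (c ^ 2 * c ^ 2) * frobeniusNormSq (fderiv ℝ (curl (u (c ^ 2 * s))) (c • y)))) =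
      c ^ 2 * c ^ 2 * (-(c ^ 2 * s) * (⟪curl (u (c ^ 2 * s)) (c • y),
        (fderiv ℝ (u (c ^ 2 * s)) (c • y)) (curl (u (c ^ 2 * s)) (c • y))⟫_ℝ -
        a * frobeniusNormSq (fderiv ℝ (curl (u (c ^ 2 * s))) (c • y)))) := by ring
  have e8 : c ^ 2 * (c ^ 2 * ⟪curl (u (c ^ 2 * s)) (c • y), curl (u (c ^ 2 * s)) (c • y)⟫_ℝ) =
      c ^ 2 * c ^ 2 * ⟪curl (u (c ^ 2 * s)) (c • y), curl (u (c ^ 2 * s)) (c • y)⟫_ℝ := by ring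
  rw [e7, e8]
  exact h2

/-- **Pointwise closedness under the limits of the class.**  Along a KNSS-convergent sequence of the class
(uniform convergence on the slab pieces, pointwise gradients), if the hypothesis holds at `(s, y)` for all late
members then it holds at `(s, y)` for the limit. [cite: KochNadirashviliSereginSverak2009, Prop. 4.1 (arXiv:0709.3599)] -/
theorem critProdCredit_of_limit_at {a : ℝ} {w : ℕ → ℝ → EuclideanSpace ℝ (Fin 3) → EuclideanSpace ℝ (Fin 3)}
    {W : ℝ → EuclideanSpace ℝ (Fin 3) → EuclideanSpace ℝ (Fin 3)}
    (hw : ∀ k, IsTypeIAncientMild C (w k)) (hW : IsTypeIAncientMild C W)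
    (hunif : ∀ n : ℕ, TendstoUniformlyOn (fun j z => w j z.1 z.2) (fun z => W z.1 z.2) atTop
      (Icc (-((n : ℝ) + 2)) (-(1 / ((n : ℝ) + 2))) ×ˢ
        closedBall (0 : EuclideanSpace ℝ (Fin 3)) ((n : ℝ) + 2)))
    (hgr : ∀ t < 0, ∀ x, Tendsto (fun j => fderiv ℝ (w j t) x) atTop (𝓝 (fderiv ℝ (W t) x)))
    {s : ℝ} (hs : s < 0) (y : EuclideanSpace ℝ (Fin 3))
    (h : ∀ᶠ k in atTop, (-s) * (⟪curl (w k s) y, fderiv ℝ (w k s) y (curl (w k s) y)⟫_ℝ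
        - a * frobeniusNormSq (fderiv ℝ (curl (w k s)) y)) ≤ ⟪curl (w k s) y, curl (w k s) y⟫_ℝ) :
    (-s) * (⟪curl (W s) y, fderiv ℝ (W s) y (curl (W s) y)⟫_ℝ
        - a * frobeniusNormSq (fderiv ℝ (curl (W s)) y)) ≤ ⟪curl (W s) y, curl (W s) y⟫_ℝ := by
  have hD : Tendsto (fun j => fderiv ℝ (w j s) y) atTop (𝓝 (fderiv ℝ (W s) y)) := hgr s hs y
  have hc : Tendsto (fun j => curl (w j s) y) atTop (𝓝 (curl (W s) y)) := tendsto_curl_of_fderiv hD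
  have hG : Tendsto (fun j => fderiv ℝ (curl (w j s)) y) atTop (𝓝 (fderiv ℝ (curl (W s)) y)) :=
    tendsto_fderiv_curl_of_unif hw hW hunif hs y
  have happ : Tendsto (fun j => fderiv ℝ (w j s) y (curl (w j s) y)) atTop
      (𝓝 (fderiv ℝ (W s) y (curl (W s) y))) :=
    ((isBoundedBilinearMap_apply (𝕜 := ℝ) (E := EuclideanSpace ℝ (Fin 3))
      (F := EuclideanSpace ℝ (Fin 3))).continuous.tendsto (fderiv ℝ (W s) y, curl (W s) y)).comp (hD.prodMk_nhds hc)
  have hF : Tendsto (fun j => frobeniusNormSq (fderiv ℝ (curl (w j s)) y)) atTop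
      (𝓝 (frobeniusNormSq (fderiv ℝ (curl (W s)) y))) := (continuous_frobeniusNormSq'.tendsto _).comp hG
  have h1 : Tendsto (fun j => (-s) * (⟪curl (w j s) y, fderiv ℝ (w j s) y (curl (w j s) y)⟫_ℝ
      - a * frobeniusNormSq (fderiv ℝ (curl (w j s)) y))) atTop
      (𝓝 ((-s) * (⟪curl (W s) y, fderiv ℝ (W s) y (curl (W s) y)⟫_ℝ
        - a * frobeniusNormSq (fderiv ℝ (curl (W s)) y)))) :=
    ((hc.inner happ).sub (hF.const_mul a)).const_mul (-s)
  have h2 : Tendsto (fun j => ⟪curl (w j s) y, curl (w j s) y⟫_ℝ) atTop (𝓝 ⟪curl (W s) y, curl (W s) y⟫_ℝ) :=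
    hc.inner hc
  exact le_of_tendsto_of_tendsto h1 h2 h

/-! ### The regional hot spot: the hypothesis on `(−∞, τ]` kills the vorticity there -/

/-- **REGIONAL HOT SPOT.**  `a < 1`, `V ∈ 𝔓(C)` and `(−s)(⟪ω, DV ω⟫ − a|∇ω|²_F) ≤ |ω|²` on `(−∞, τ] × ℝ³`
(`τ < 0`) ⇒ `curl V ≡ 0` on `(−∞, τ] × ℝ³`. [cite: KochNadirashviliSereginSverak2009, Prop. 4.1 and Lemma 3.1 (arXiv:0709.3599)] -/
theorem curl_eq_zero_until_of_critProdCredit_until {a : ℝ} (ha : a < 1) (hV : IsTypeIAncientMild C V)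
    {τ : ℝ} (hτ : τ < 0)
    (hP : ∀ s : ℝ, s ≤ τ → ∀ y, (-s) * (⟪curl (V s) y, fderiv ℝ (V s) y (curl (V s) y)⟫_ℝ
        - a * frobeniusNormSq (fderiv ℝ (curl (V s)) y)) ≤ ⟪curl (V s) y, curl (V s) y⟫_ℝ) :
    ∀ s : ℝ, s ≤ τ → ∀ y, curl (V s) y = 0 := by
  -- adapted from Theorems/…PoloidalWindowRigidityEnstrophyHotSpot.lean (`exists_enstrophy_hotSpot`, nsreg-p7 g5)
  intro s₀ hs₀ y₀
  by_contra hne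
  have hs₀0 : s₀ < 0 := lt_of_le_of_lt hs₀ hτ
  have ha1 : 0 < 1 - a := sub_pos.2 ha
  have hrate : HasTypeITimeDecay C V := hV.hasTypeITimeDecay
  have hcont : ContinuousOn (uncurry V) (Iio (0 : ℝ) ×ˢ univ) := hV.continuousOn_uncurry
  have hmild : ∀ s t : ℝ, s < t → t < 0 → ∀ x,
      V t x = UnboundedOperators.heatExtension (V s) (t - s) x - oseenDuhamel 1 s V V t x :=
    fun s t hst ht x => hV.mild_eq_heatExtension hst ht x
  -- ## the scale-invariant enstrophy and its supremum over `t ≤ τ`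
  set E : ℝ → EuclideanSpace ℝ (Fin 3) → ℝ := fun t x => (-t) ^ 2 * ⟪curl (V t) x, curl (V t) x⟫_ℝ with hEdef
  obtain ⟨C₂, hC₂⟩ := exists_curl_rate_of_class hrate hcont hmild
  have hEle : ∀ t < 0, ∀ x, E t x ≤ C₂ ^ 2 := by
    intro t ht x
    have h1 : ‖curl (V t) x‖ ≤ C₂ / (-t) := hC₂ t ht x
    have h2 : (-t) * ‖curl (V t) x‖ ≤ C₂ := by
      rw [le_div_iff₀ (neg_pos.2 ht)] at h1; linarith
    have h3 : 0 ≤ (-t) * ‖curl (V t) x‖ := mul_nonneg (neg_pos.2 ht).le (norm_nonneg _)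
    simp only [hEdef, real_inner_self_eq_norm_sq]
    nlinarith
  set S : Set ℝ := {m | ∃ t : ℝ, t ≤ τ ∧ ∃ x, m = E t x} with hSdef
  have hSbdd : BddAbove S :=
    ⟨C₂ ^ 2, by rintro m ⟨t, ht, x, rfl⟩; exact hEle t (lt_of_le_of_lt ht hτ) x⟩
  have hS0 : E s₀ y₀ ∈ S := ⟨s₀, hs₀, y₀, rfl⟩
  set M : ℝ := sSup S with hMdef
  have hEM : ∀ t : ℝ, t ≤ τ → ∀ x, E t x ≤ M := fun t ht x => le_csSup hSbdd ⟨t, ht, x, rfl⟩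
  have hE0pos : 0 < E s₀ y₀ := by
    simp only [hEdef, real_inner_self_eq_norm_sq]
    exact mul_pos (pow_pos (neg_pos.2 hs₀0) 2) (pow_pos (norm_pos_iff.2 hne) 2)
  have hMpos : 0 < M := hE0pos.trans_le (hEM s₀ hs₀ y₀)
  -- ## near-maximal points in the region
  have hpts : ∀ k : ℕ, ∃ t : ℝ, t ≤ τ ∧ ∃ x : EuclideanSpace ℝ (Fin 3), M - 1 / ((k : ℝ) + 1) < E t x := by
    intro k
    have hlt : M - 1 / ((k : ℝ) + 1) < sSup S := by
      have : (0 : ℝ) < 1 / ((k : ℝ) + 1) := by positivity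
      rw [hMdef]; linarith
    obtain ⟨m, ⟨t, ht, x, rfl⟩, hm⟩ := exists_lt_of_lt_csSup ⟨_, hS0⟩ hlt
    exact ⟨t, ht, x, hm⟩
  choose tk htk xk hxk using hpts
  have htk0 : ∀ k, tk k < 0 := fun k => lt_of_le_of_lt (htk k) hτ
  -- ## renormalisation to the hot spot `(−1, 0)`; `t ≤ −1` is mapped INTO `t ≤ τ`
  set vk : ℕ → ℝ → EuclideanSpace ℝ (Fin 3) → EuclideanSpace ℝ (Fin 3) := fun k =>
    nsRescale (Real.sqrt (-tk k)) (fun t x => V t (xk k + x)) with hvk_def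
  have hck : ∀ k, 0 < Real.sqrt (-tk k) := fun k => Real.sqrt_pos.2 (neg_pos.2 (htk0 k))
  have hck2 : ∀ k, Real.sqrt (-tk k) ^ 2 = -tk k := fun k => Real.sq_sqrt (neg_pos.2 (htk0 k)).le
  have hvk : ∀ k, IsTypeIAncientMild C (vk k) := fun k =>
    isTypeIAncientMild_nsRescale (isTypeIAncientMild_translate hV (xk k)) (hck k)
  have hreg : ∀ k, ∀ t : ℝ, t ≤ -1 → Real.sqrt (-tk k) ^ 2 * t ≤ τ := by
    intro k t ht
    rw [hck2]
    nlinarith [htk k, htk0 k, ht]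
  have hvkP : ∀ k, ∀ s : ℝ, s ≤ -1 → ∀ y, (-s) * (⟪curl (vk k s) y, fderiv ℝ (vk k s) y (curl (vk k s) y)⟫_ℝ
      - a * frobeniusNormSq (fderiv ℝ (curl (vk k s)) y)) ≤ ⟪curl (vk k s) y, curl (vk k s) y⟫_ℝ := by
    intro k s hs y
    simp only [hvk_def]
    exact critProdCredit_nsRescale_at (hck k)
      (critProdCredit_translate_at (u := V) (xk k) (hP _ (hreg k s hs) _))
  -- the scale-invariant enstrophy of `vk k` is that of `V` at the moved point
  have hEvk : ∀ k, ∀ t < 0, ∀ x, (-t) ^ 2 * ⟪curl (vk k t) x, curl (vk k t) x⟫_ℝ =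
      E (Real.sqrt (-tk k) ^ 2 * t) (xk k + Real.sqrt (-tk k) • x) := by
    intro k t ht x
    simp only [hvk_def, hEdef]
    exact critEnstrophy_nsRescale_translate _ _ _ _ _
  have hEvk_le : ∀ k, ∀ t : ℝ, t ≤ -1 → ∀ x, (-t) ^ 2 * ⟪curl (vk k t) x, curl (vk k t) x⟫_ℝ ≤ M := by
    intro k t ht x
    rw [hEvk k t (by linarith) x]
    exact hEM _ (hreg k t ht) _
  have hEvk_one : ∀ k, ⟪curl (vk k (-1)) 0, curl (vk k (-1)) 0⟫_ℝ = E (tk k) (xk k) := by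
    intro k
    have h := hEvk k (-1) (by norm_num) 0
    rw [hck2, smul_zero, add_zero] at h
    have e : -tk k * (-1 : ℝ) = tk k := by ring
    rw [e] at h
    simpa using h
  -- ## extraction of a KNSS limit (uniform on slab pieces: second derivatives converge too)
  obtain ⟨φ, hφ, W, hW, hunif, hpt, hgrad⟩ := Compactness.seqLimit hvk
  have hPW : ∀ s : ℝ, s ≤ -1 → ∀ y, (-s) * (⟪curl (W s) y, fderiv ℝ (W s) y (curl (W s) y)⟫_ℝ
      - a * frobeniusNormSq (fderiv ℝ (curl (W s)) y)) ≤ ⟪curl (W s) y, curl (W s) y⟫_ℝ :=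
    fun s hs y => critProdCredit_of_limit_at (fun j => hvk (φ j)) hW hunif hgrad (by linarith) y
      (Eventually.of_forall fun j => hvkP (φ j) s hs y)
  have hconv : ∀ t < 0, ∀ x, Tendsto (fun j => ⟪curl (vk (φ j) t) x, curl (vk (φ j) t) x⟫_ℝ) atTop
      (𝓝 ⟪curl (W t) x, curl (W t) x⟫_ℝ) := by
    intro t ht x
    have hc := tendsto_curl_of_fderiv (hgrad t ht x)
    exact hc.inner hc
  have hle : ∀ t : ℝ, t ≤ -1 → ∀ x, (-t) ^ 2 * ⟪curl (W t) x, curl (W t) x⟫_ℝ ≤ M := by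
    intro t ht x
    have h := (hconv t (by linarith) x).const_mul ((-t) ^ 2)
    exact le_of_tendsto' h fun j => hEvk_le (φ j) t ht x
  have hmax : ⟪curl (W (-1)) 0, curl (W (-1)) 0⟫_ℝ = M := by
    have h1 := hconv (-1) (by norm_num) 0
    have hεj : Tendsto (fun j : ℕ => M - 1 / ((φ j : ℝ) + 1)) atTop (𝓝 M) := by
      have h0 : Tendsto (fun j : ℕ => 1 / ((φ j : ℝ) + 1)) atTop (𝓝 0) := by
        have ha : Tendsto (fun j : ℕ => (φ j : ℝ) + 1) atTop atTop := by
          refine tendsto_atTop_add_const_right _ 1 ?_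
          exact tendsto_natCast_atTop_atTop.comp hφ.tendsto_atTop
        refine (tendsto_inv_atTop_zero.comp ha).congr fun j => ?_
        simp [one_div, Function.comp]
      simpa using (tendsto_const_nhds (x := M)).sub h0
    have h2 : Tendsto (fun j => ⟪curl (vk (φ j) (-1)) 0, curl (vk (φ j) (-1)) 0⟫_ℝ) atTop (𝓝 M) := by
      refine tendsto_of_tendsto_of_tendsto_of_le_of_le hεj tendsto_const_nhds (fun j => ?_) (fun j => ?_)
      · rw [hEvk_one]; exact (hxk (φ j)).le
      · rw [hEvk_one]; exact hEM _ (htk (φ j)) _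
    exact tendsto_nhds_unique h1 h2
  -- ## the strong maximum principle on the slab `[−2, −1] × ℝ³` (maximum at the top)
  have hWrate : HasTypeITimeDecay C W := hW.hasTypeITimeDecay
  have hWcont : ContinuousOn (uncurry W) (Iio (0 : ℝ) ×ˢ univ) := hW.continuousOn_uncurry
  have hWmild : ∀ s t : ℝ, s < t → t < 0 → ∀ x,
      W t x = UnboundedOperators.heatExtension (W s) (t - s) x - oseenDuhamel 1 s W W t x :=
    fun s t hst ht x => hW.mild_eq_heatExtension hst ht x
  have hWdiv : ∀ t < 0, VectorCalculus.IsDivFree (W t) := fun t ht => hW.isDivFree ht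
  -- ## the critically weighted enstrophy `Q = t² |ω|²` and its dissipation `2(1−a)t²|∇ω|²_F`
  set q : ℝ → EuclideanSpace ℝ (Fin 3) → ℝ := fun τ y => ⟪curl (W τ) y, curl (W τ) y⟫_ℝ with hqdef
  set Q : ℝ → EuclideanSpace ℝ (Fin 3) → ℝ := fun τ y => τ ^ 2 * q τ y with hQdef
  set Qt : ℝ → EuclideanSpace ℝ (Fin 3) → ℝ := fun τ y => deriv (fun τ' => Q τ' y) τ with hQtdef
  set D : ℝ → EuclideanSpace ℝ (Fin 3) → ℝ := fun τ y =>
    2 * (1 - a) * τ ^ 2 * frobeniusNormSq (fderiv ℝ (curl (W τ)) y) with hDdef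
  have hg : ∀ τ < (0 : ℝ), HasDerivAt (fun τ : ℝ => τ ^ 2) (2 * τ) τ := fun τ _ => by
    simpa using hasDerivAt_pow 2 τ
  have hid := fun τ (hτ : τ < 0) y => weightedEnstrophy_identity hWrate hWcont hWmild hWdiv hg hτ y
  -- ## the slab `[−2, −1/2] × ℝ³`
  have hslab : ∀ t ∈ Icc (-2 : ℝ) (-1), t < 0 := fun t ht => by linarith [ht.2]
  obtain ⟨B, hB⟩ := bdd_of_hasTypeITimeDecay hWrate (1 / 4) (by norm_num)
  have hbA : ∀ t ∈ Icc (-2 : ℝ) (-1), ∀ x, ‖W t x‖ ≤ B := fun t ht x => hB t (by linarith [ht.2]) x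
  have hsmω : IsSmoothSpaceTimeOn (Iio 0) (vorticity W) :=
    (show IsSmoothSpaceTimeOn (Iio 0) W from hW.contDiffOn).isSmoothSpaceTimeOn_vorticity isOpen_Iio.uniqueDiffOn
  have hq_c : ContinuousOn (uncurry q) (Icc (-2 : ℝ) (-1) ×ˢ univ) := by
    have hωc : ContinuousOn (uncurry (vorticity W)) (Icc (-2 : ℝ) (-1) ×ˢ univ) :=
      hsmω.continuousOn.mono (prod_mono (fun t ht => hslab t ht) Subset.rfl)
    have h : ContinuousOn (fun z => ⟪uncurry (vorticity W) z, uncurry (vorticity W) z⟫_ℝ)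
        (Icc (-2 : ℝ) (-1) ×ˢ univ) := hωc.inner hωc
    refine h.congr fun z _ => ?_
    simp only [hqdef, uncurry, vorticity_apply]
  have hQ_c : ContinuousOn (uncurry Q) (Icc (-2 : ℝ) (-1) ×ˢ univ) := by
    have hg1 : ContinuousOn (fun z : ℝ × EuclideanSpace ℝ (Fin 3) => z.1 ^ 2) (Icc (-2 : ℝ) (-1) ×ˢ univ) :=
      (continuous_fst.pow 2).continuousOn
    refine (hg1.mul hq_c).congr fun z _ => ?_
    rcases z with ⟨a, b⟩
    rfl
  have hq2 : ∀ t < (0 : ℝ), ContDiff ℝ 2 (q t) := fun t ht => by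
    have hΩ : ContDiff ℝ 2 (curl (W t)) :=
      contDiff_curl (n := 2) (analyticOnNhd_slice hWcont (bdd_of_hasTypeITimeDecay hWrate) hWmild ht).contDiff
    exact hΩ.inner ℝ hΩ
  have hQ2 : ∀ t ∈ Icc (-2 : ℝ) (-1), ContDiff ℝ 2 (Q t) := fun t ht => by
    have h : ContDiff ℝ 2 (fun y => t ^ 2 * q t y) := contDiff_const.mul (hq2 t (hslab t ht))
    exact h
  have hQt : ∀ x, ∀ t ∈ Icc (-2 : ℝ) (-1), HasDerivAt (fun τ => Q τ x) (Qt t x) t :=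
    fun x t ht => (hid t (hslab t ht) x).1
  have hD0 : ∀ t ∈ Icc (-2 : ℝ) (-1), ∀ x, 0 ≤ D t x := fun t _ x => by
    simp only [hDdef]
    exact mul_nonneg (by positivity) (frobeniusNormSq_nonneg _)
  have hlawD : ∀ t ∈ Icc (-2 : ℝ) (-1), ∀ x,
      Qt t x + fderiv ℝ (Q t) x (W t x) - (Δ (Q t)) x ≤ -D t x := by
    intro t ht x
    have htn : t < 0 := hslab t ht
    have h := (hid t htn x).2
    have hP := hPW t ht.2 x
    have h1 : t ^ 2 * ⟪curl (W t) x, fderiv ℝ (W t) x (curl (W t) x)⟫_ℝ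
        - a * t ^ 2 * frobeniusNormSq (fderiv ℝ (curl (W t)) x) ≤ (-t) * q t x := by
      have h2 := mul_le_mul_of_nonneg_left hP (neg_pos.2 htn).le
      simp only [hqdef]
      nlinarith [h2]
    simp only [hQtdef, hQdef, hDdef, hqdef] at h h1 ⊢
    rw [h]
    nlinarith [h1]
  have hle' : ∀ t ∈ Icc (-2 : ℝ) (-1), ∀ x, Q t x ≤ M := fun t ht x => by
    have h := hle t ht.2 x
    rw [neg_sq] at h
    exact h
  have hmaxQ : Q (-1) 0 = M := by
    simp only [hQdef, hqdef, hmax]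
    norm_num
  have hts : (-1 : ℝ) ∈ Ioc (-2 : ℝ) (-1) := by constructor <;> norm_num
  have hdis := dissipation_eq_zero_of_max (t₀ := (-2 : ℝ)) (T := -1) hbA hQ_c hQ2 hQt hD0 hlawD hle' hts hmaxQ
  -- ## on the slice `s = −3/2` the vorticity gradient vanishes
  have hs₁ : (-3 / 2 : ℝ) ∈ Ioo (-2 : ℝ) (-1) := by constructor <;> norm_num
  have hF : ∀ x, fderiv ℝ (curl (W (-3 / 2))) x = 0 := by
    intro x
    have h := hdis (-3 / 2) hs₁ x
    have hfrob : frobeniusNormSq (fderiv ℝ (curl (W (-3 / 2))) x) = 0 := by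
      have h2 : (2 : ℝ) * (1 - a) * (-3 / 2) ^ 2 ≠ 0 := by positivity
      simp only [hDdef] at h
      exact (mul_eq_zero.1 h).resolve_left h2
    have hn : ‖fderiv ℝ (curl (W (-3 / 2))) x‖ ^ 2 ≤ 0 := by
      have h3 := sq_opNorm_le_frobeniusNormSq (fderiv ℝ (curl (W (-3 / 2))) x)
      rw [hfrob] at h3
      exact h3
    have hn0 : ‖fderiv ℝ (curl (W (-3 / 2))) x‖ = 0 := by
      nlinarith [norm_nonneg (fderiv ℝ (curl (W (-3 / 2))) x)]
    exact norm_eq_zero.1 hn0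
  -- so `curl W(−3/2, ·)` is constant, in particular translation-invariant along `e₀`
  have hΩd : Differentiable ℝ (curl (W (-3 / 2))) :=
    (contDiff_curl (n := 1) (analyticOnNhd_slice hWcont (bdd_of_hasTypeITimeDecay hWrate) hWmild
      (by norm_num)).contDiff).differentiable one_ne_zero
  have hconst : ∀ (y : EuclideanSpace ℝ (Fin 3)) (l : ℝ),
      curl (W (-3 / 2)) (y + l • EuclideanSpace.single 0 (1 : ℝ)) = curl (W (-3 / 2)) y :=
    fun y l => is_const_of_fderiv_eq_zero hΩd hF _ _
  have he : (EuclideanSpace.single (0 : Fin 3) (1 : ℝ) : EuclideanSpace ℝ (Fin 3)) ≠ 0 := fun h => by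
    simpa using congrArg (fun w : EuclideanSpace ℝ (Fin 3) => w 0) h
  have hW0 : ∀ t < 0, ∀ x, W t x = 0 :=
    eq_zero_of_curl_translate_eq_slice hWrate hWcont hWmild hWdiv (by norm_num : (-3 / 2 : ℝ) < 0) he hconst
  -- ## contradiction: `|curl W(−1,0)|² = M > 0`
  have hc0 : curl (W (-1)) 0 = 0 := by
    have hslice : W (-1) = fun _ => 0 := funext fun x => hW0 (-1) (by norm_num) x
    rw [curl_eq_curlCLM, hslice]
    simp
  rw [hc0, inner_zero_left] at hmax
  exact absurd hmax hMpos.ne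

/-! ### In the far past: a Liouville theorem -/

/-- **CRITICAL PRODUCTION WITH PALINSTROPHY CREDIT IN THE FAR PAST FORCES `V ≡ 0`.**  `a < 1`, `V ∈ 𝔓(C)`
(`IsTypeIAncientMild C V`, no envelope, no law) and `(−s)(⟪ω, DV ω⟫ − a|∇ω|²_F) ≤ |ω|²` on `(−∞, τ] × ℝ³` for
some `τ < 0` ⇒ `V ≡ 0` on `t < 0`. [cite: KochNadirashviliSereginSverak2009, Lemma 3.1, Prop. 4.1 and Remark 6.1 (arXiv:0709.3599)] -/
theorem eq_zero_of_critProdCredit_farPast {a : ℝ} (ha : a < 1) (hV : IsTypeIAncientMild C V) {τ : ℝ} (hτ : τ < 0)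
    (hP : ∀ s : ℝ, s ≤ τ → ∀ y, (-s) * (⟪curl (V s) y, fderiv ℝ (V s) y (curl (V s) y)⟫_ℝ
        - a * frobeniusNormSq (fderiv ℝ (curl (V s)) y)) ≤ ⟪curl (V s) y, curl (V s) y⟫_ℝ) :
    ∀ t < 0, ∀ x, V t x = 0 := by
  have hcurl := curl_eq_zero_until_of_critProdCredit_until ha hV hτ hP
  have hconst : ∀ t : ℝ, t ≤ τ → ∀ x, V t x = V t 0 := fun t ht x =>
    eq_of_curl_eq_zero_of_isDivFree_of_bounded ((hV.contDiff_slice (lt_of_le_of_lt ht hτ)).of_le (by norm_cast))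
      (hcurl t ht) (hV.isDivFree (lt_of_le_of_lt ht hτ)) (fun z => hV.norm_le (lt_of_le_of_lt ht hτ) z) x 0
  exact eq_zero_of_const_slices_until hV hτ hconst

/-- **PORTRAIT: super-critical production recedes into the far past.**  A KNSS-gauge Type-I field not identically
zero on `t < 0` has, for every `a < 1` and every `τ < 0`, a point `(s, y)` with `s ≤ τ` and
`|ω(s,y)|² < (−s)(⟪ω, DV ω⟫ − a|∇ω|²_F)(s, y)`. [cite: KochNadirashviliSereginSverak2009, Prop. 4.1 (arXiv:0709.3599)] -/
theorem production_excess_recedes_of_ne_zero {a : ℝ} (ha : a < 1) (hV : IsTypeIAncientMild C V)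
    (hne : ∃ t : ℝ, t < 0 ∧ ∃ x, V t x ≠ 0) {τ : ℝ} (hτ : τ < 0) :
    ∃ s : ℝ, s ≤ τ ∧ ∃ y : EuclideanSpace ℝ (Fin 3),
      ⟪curl (V s) y, curl (V s) y⟫_ℝ < (-s) * (⟪curl (V s) y, fderiv ℝ (V s) y (curl (V s) y)⟫_ℝ
        - a * frobeniusNormSq (fderiv ℝ (curl (V s)) y)) := by
  by_contra h
  push Not at h
  obtain ⟨t, ht, x, hx⟩ := hne
  exact hx (eq_zero_of_critProdCredit_farPast ha hV hτ (fun s hs y => h s hs y) t ht x)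

end Summit.NavierStokesRegularity.NavierStokesRegularity.Theorems.FiniteDissipationLiouville.CriticalProduction

end
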